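import Mathlib
import Summits.Ventures.PercRepro.TriangleCapTwoTrianglesEightE

/-!
# PercRepro — FOUR BELOW THE DIAGONAL, TWO VERTEX-DISJOINT TRIANGLES, EVERY `k ≥ 10` (p3, gen 39; part 122)

Gen 38's module TriangleCapThreeBelowTwoTrianglesA re-assembled at `r = 4`: the refined far count of
TriangleCapTwoTrianglesEightB (`two_triangles_far_count`) on `S = T₁ ∪ T₂`, two vertex-disjoint triangles, with the
density `2m = Q + 2 Σ s + Σ d` kept (`two_mul_card_edges_eq_adjPairs_add`): with `W ≤ 3 s`, `s ≤ 2` off `S`,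
`Σ s ≤ 2 |Sᶜ|` and `12 ≤ Q ≤ 18`, `Σ deficit ≥ |Sᶜ| Q + 84 − 6 Q − 16 |Sᶜ| + 4 m`, and `2m ≥ 6k − 26` gives
`Σ deficit ≥ |Sᶜ| Q − 6Q − 4|Sᶜ| + 104`, whence **`eight_mul_card_le_sum_deficit_add_twentyeight_of_disjoint`**:
`8k ≤ Σ deficit + 28` for `k ≥ 10` — TIGHT at `(10, 17)` (`|Sᶜ| = 4`, `Q = 18`: the prism plus four vertices
hanging on one non-matched pair, `Σ d² = 150 = 170 − 20`, the only extremal configuration with triangles at the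
first cell of the sub-diagonal `r = 4`).  With `|T₃| ≤ 12` (`card_triangles3_le_twelve`):
**`two_triangles_stability_four_of_disjoint`**: `K₄⁻`-free, `k ≥ 10`, `2m ≥ 6k − 26`, two vertex-disjoint
triangles carrying every triangle ⇒ `Σ_v d(v)² + 4 (k − 5) ≤ m k`.  Numbers (mining/p3/g39/tri4b.c, every graph
whose triangles are exactly the two given ones): the minimum of `mk − Σ d² − 4(k − 5)` over `m ≥ 3k − 13` is `0` at
`k = 10` (36 graphs, `m = 17`) and `8` at `k = 11`.  Axioms: standard.
-/

namespace PercRepro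

namespace TriangleCap

namespace C047

open Finset

variable {V : Type*} [Fintype V] [DecidableEq V]

/-- **THE FAR COUNT FOR TWO VERTEX-DISJOINT TRIANGLES AT `r = 4`:** `8k ≤ Σ_p deficit(p) + 28` for `k ≥ 10` and
`2m ≥ 6k − 26` — tight on the prism plus four vertices hanging on one non-matched pair at `(10, 17)`. -/
theorem eight_mul_card_le_sum_deficit_add_twentyeight_of_disjoint (D : SimpleGraph V) [DecidableRel D.Adj]
    (T₁ T₂ : Finset V) (h₁ : T₁.card = 3) (h₂ : T₂.card = 3) (hdisj : Disjoint T₁ T₂)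
    (hcl₁ : ∀ x ∈ T₁, ∀ y ∈ T₁, x ≠ y → D.Adj x y) (hcl₂ : ∀ x ∈ T₂, ∀ y ∈ T₂, x ≠ y → D.Adj x y)
    (hone₁ : ∀ z, z ∉ T₁ → degIn D T₁ z ≤ 1) (hone₂ : ∀ z, z ∉ T₂ → degIn D T₂ z ≤ 1)
    (hk : 10 ≤ Fintype.card V) (hm : 6 * Fintype.card V ≤ 2 * D.edgeFinset.card + 26) :
    8 * Fintype.card V ≤ ∑ p ∈ adjPairsAll D, deficit D p + 28 := by
  have hint : (T₁ ∩ T₂).card ≤ 1 := by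
    rw [disjoint_iff_inter_eq_empty.mp hdisj, card_empty]
    exact Nat.zero_le _
  have hcount := two_triangles_far_count D T₁ T₂ h₁ h₂ hint hcl₁ hcl₂
  set S := T₁ ∪ T₂ with hS
  have hScard : S.card = 6 := by
    rw [hS, card_union_of_disjoint hdisj, h₁, h₂]
  have hRcard : Sᶜ.card = Fintype.card V - 6 := by rw [card_compl, hScard]
  -- the degrees into `S`: between `2` and `3` on `S`, at most `2` off `S`
  have hdeg3 : ∀ x ∈ S, degIn D S x ≤ 3 := by
    intro x hx
    rw [hS] at hx ⊢
    rw [mem_union] at hx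
    have h := degIn_union_le D T₁ T₂ x
    rcases hx with hx | hx
    · have hx2 : x ∉ T₂ := fun h' => disjoint_left.mp hdisj hx h'
      have := degIn_le_two_of_mem D h₁ hx
      have := hone₂ x hx2
      omega
    · have hx1 : x ∉ T₁ := fun h' => disjoint_left.mp hdisj h' hx
      have := degIn_le_two_of_mem D h₂ hx
      have := hone₁ x hx1
      omega
  have hdeg2 : ∀ x ∈ S, 2 ≤ degIn D S x := by
    intro x hx
    rw [hS] at hx ⊢
    rw [mem_union] at hx
    rcases hx with hx | hx
    · have := degIn_left_le_union D T₁ T₂ x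
      rw [degIn_self_of_clique D h₁ hcl₁ hx] at this
      exact this
    · have := degIn_right_le_union D T₁ T₂ x
      rw [degIn_self_of_clique D h₂ hcl₂ hx] at this
      exact this
  have hout : ∀ z ∈ Sᶜ, degIn D S z ≤ 2 := by
    intro z hz
    rw [mem_compl, hS, mem_union, not_or] at hz
    rw [hS]
    have h := degIn_union_le D T₁ T₂ z
    have := hone₁ z hz.1
    have := hone₂ z hz.2
    omega
  -- `12 ≤ Q ≤ 18` and `Σ_{T₁} + Σ_{T₂} = Q`
  have hQ : adjPairs D S = ∑ x ∈ T₁, degIn D S x + ∑ x ∈ T₂, degIn D S x := by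
    rw [adjPairs_eq_sum_degIn, hS, sum_union hdisj]
  have hQle : adjPairs D S ≤ 18 := by
    rw [adjPairs_eq_sum_degIn]
    calc ∑ x ∈ S, degIn D S x ≤ ∑ _x ∈ S, 3 := sum_le_sum hdeg3
      _ = 18 := by rw [sum_const, hScard, smul_eq_mul]
  have hQge : 12 ≤ adjPairs D S := by
    rw [adjPairs_eq_sum_degIn]
    calc 12 = ∑ _x ∈ S, 2 := by rw [sum_const, hScard, smul_eq_mul]
      _ ≤ ∑ x ∈ S, degIn D S x := sum_le_sum hdeg2
  -- the outside sums
  have hW : ∑ z ∈ Sᶜ, ∑ x ∈ S.filter (fun x => D.Adj z x), degIn D S x ≤ 3 * ∑ z ∈ Sᶜ, degIn D S z := by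
    rw [mul_sum]
    exact sum_le_sum (fun z _ => sum_degIn_le_three_mul D S hdeg3 z)
  have hsq : ∑ z ∈ Sᶜ, degIn D S z * degIn D S z ≤ 2 * ∑ z ∈ Sᶜ, degIn D S z := by
    rw [mul_sum]
    apply sum_le_sum
    intro z hz
    have := hout z hz
    nlinarith
  have hsd : ∑ z ∈ Sᶜ, degIn D S z * degIn D Sᶜ z ≤ 2 * ∑ z ∈ Sᶜ, degIn D Sᶜ z := by
    rw [mul_sum]
    apply sum_le_sum
    intro z hz
    have := hout z hz
    nlinarith
  have hs : ∑ z ∈ Sᶜ, degIn D S z ≤ 2 * Sᶜ.card := by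
    calc ∑ z ∈ Sᶜ, degIn D S z ≤ ∑ _z ∈ Sᶜ, 2 := sum_le_sum hout
      _ = 2 * Sᶜ.card := by rw [sum_const, smul_eq_mul, mul_comm]
  -- the density `2m = Q + 2 Σ s + Σ d`
  have hdens := two_mul_card_edges_eq_adjPairs_add D S
  -- assemble: `Σ deficit ≥ |Sᶜ| Q + 84 − 6Q − 16 |Sᶜ| + 4m`, then the cases `|Sᶜ| ≤ 5` / `|Sᶜ| ≥ 6`
  rw [hScard] at hcount
  set Q := adjPairs D S with hQdef
  set R := Sᶜ.card with hRdef
  set s := ∑ z ∈ Sᶜ, degIn D S z with hsdef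
  set d := ∑ z ∈ Sᶜ, degIn D Sᶜ z with hddef
  set W := ∑ z ∈ Sᶜ, ∑ x ∈ S.filter (fun x => D.Adj z x), degIn D S x with hWdef
  set sq := ∑ z ∈ Sᶜ, degIn D S z * degIn D S z with hsqdef
  set sd := ∑ z ∈ Sᶜ, degIn D S z * degIn D Sᶜ z with hsddef
  set Def := ∑ p ∈ adjPairsAll D, deficit D p with hDef
  set m := D.edgeFinset.card with hmdef
  clear_value Q R s d W sq sd Def m
  have hk' : Fintype.card V = R + 6 := by omega
  rw [hk'] at hm ⊢
  have hmain : R * Q + 104 ≤ Def + 6 * Q + 4 * R := by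
    linarith only [hcount, hQ, hW, hsq, hsd, hs, hdens, hm]
  have hR4 : 4 ≤ R := by omega
  rcases Nat.lt_or_ge R 6 with hR | hR
  · interval_cases R <;> omega
  · obtain ⟨r, hr⟩ : ∃ r, R = r + 6 := ⟨R - 6, by omega⟩
    subst hr
    have h12 : r * 12 ≤ r * Q := Nat.mul_le_mul_left r hQge
    rw [add_mul] at hmain
    linarith only [hmain, h12]

/-- **FOUR BELOW THE DIAGONAL, TWO VERTEX-DISJOINT TRIANGLES, `k ≥ 10`:** `K₄⁻`-free, `2m ≥ 6k − 26`, every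
triangle on one of the two vertex-disjoint triangles `u v w`, `a b c` ⇒ `Σ_v d(v)² + 4 (k − 5) ≤ m k`. -/
theorem two_triangles_stability_four_of_disjoint (D : SimpleGraph V) [DecidableRel D.Adj] (hK : K4mFree D)
    (hk : 10 ≤ Fintype.card V) (hm : 6 * Fintype.card V ≤ 2 * D.edgeFinset.card + 26) {u v w a b c : V}
    (huv : D.Adj u v) (huw : D.Adj u w) (hvw : D.Adj v w) (hab : D.Adj a b) (hac : D.Adj a c) (hbc : D.Adj b c)
    (hT3 : ∀ x y z, D.Adj x y → D.Adj x z → D.Adj y z → x = u ∨ x = v ∨ x = w ∨ x = a ∨ x = b ∨ x = c)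
    (hdisj : ∀ t, (t = u ∨ t = v ∨ t = w) → ¬ (t = a ∨ t = b ∨ t = c)) :
    ∑ v, deg D v * deg D v + 4 * (Fintype.card V - 5) ≤ D.edgeFinset.card * Fintype.card V := by
  set T₁ : Finset V := {u, v, w} with hT₁
  set T₂ : Finset V := {a, b, c} with hT₂
  have h₁ : T₁.card = 3 := card_triple huv.ne huw.ne hvw.ne
  have h₂ : T₂.card = 3 := card_triple hab.ne hac.ne hbc.ne
  have hd : Disjoint T₁ T₂ := by
    rw [disjoint_left]
    intro t ht1 ht2
    rw [hT₁, mem_insert, mem_insert, mem_singleton] at ht1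
    rw [hT₂, mem_insert, mem_insert, mem_singleton] at ht2
    exact hdisj t ht1 ht2
  have hcl₁ := clique_triple D huv huw hvw
  have hcl₂ := clique_triple D hab hac hbc
  have hone₁ : ∀ z, z ∉ T₁ → degIn D T₁ z ≤ 1 := fun z hz => degIn_le_one_of_triangle D hK huv huw hvw hz
  have hone₂ : ∀ z, z ∉ T₂ → degIn D T₂ z ≤ 1 := fun z hz => degIn_le_one_of_triangle D hK hab hac hbc hz
  have hT : ∀ x y z, D.Adj x y → D.Adj x z → D.Adj y z → x ∈ T₁ ∪ T₂ := by
    intro x y z hxy hxz hyz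
    rw [mem_union, hT₁, hT₂, mem_insert, mem_insert, mem_singleton, mem_insert, mem_insert, mem_singleton]
    rcases hT3 x y z hxy hxz hyz with h | h | h | h | h | h
    · exact Or.inl (Or.inl h)
    · exact Or.inl (Or.inr (Or.inl h))
    · exact Or.inl (Or.inr (Or.inr h))
    · exact Or.inr (Or.inl h)
    · exact Or.inr (Or.inr (Or.inl h))
    · exact Or.inr (Or.inr (Or.inr h))
  have hdef := eight_mul_card_le_sum_deficit_add_twentyeight_of_disjoint D T₁ T₂ h₁ h₂ hd hcl₁ hcl₂ hone₁ hone₂ hk hm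
  have h12 := card_triangles3_le_twelve D T₁ T₂ h₁ h₂ hd hcl₁ hcl₂ hone₁ hone₂ hT
    (fun x y z z' hxy hxz hyz hxz' hyz' => eq_of_common_nbr D hK hxy hxz hyz hxz' hyz')
  have hid := two_mul_sum_deg_sq_add_sum_deficit D
  have hmk : 2 * (D.edgeFinset.card * Fintype.card V) = 2 * D.edgeFinset.card * Fintype.card V := by ring
  omega

end C047

end TriangleCap

end PercRepro
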